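import Mathlib
import HarnessLib
import Summits.Langlands.Langlands.Statement
import Summits.Langlands.Langlands.Theorems.ParityBlindBianchiArtinWeightRealisationLevelStubExistsCharacterTransport
import Summits.Langlands.Langlands.Theorems.ParityBlindBianchiArtinWeightRealisationLevelStubExistsHeckeCharacterOfTransport
import Summits.Langlands.Langlands.Theorems.ParityBlindBianchiArtinWeightRealisationLevelStubTwistDictionaryAt
import Literature.NumberTheory.Automorphic.AutomorphicTwistHecke
import Literature.NumberTheory.GaloisRepresentations.ArtinCharacterReciprocityProofs

/-!
# Twisting a.e. Satake–Frobenius compatibility by a finite-order character — helper file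
(`--supports stmt-Langlands-15111`), line `Sketch`, continuation lead c15

Crux R′ = `ParityBlindBianchi.ArtinWeightRealisationLevel` (stmt-Langlands-15111).  This file proves
the registered stub `stub_exists_eventually_satakeFrobCompatibleAt_twist`, the engine of the
odd-descent-up-to-twist sector: for `K` a number field, `ι : ℚ̄_p ≃+* ℂ`, a cuspidal Borel–Jacquet
datum `π` on `GL₂(𝔸_K)` which is Satake–Frobenius compatible (m = 1 arithmetic normalisation,
`Summit.Langlands.SatakeFrobCompatibleAt`) with `σ₀ : Γ_K → GL₂(ℚ̄_p)` at all but finitely many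
places, and a continuous character `ψ : Γ_K → ℚ̄_pˣ` of finite image, there is a cuspidal datum
`π'` (namely `π ⊗ (ω ∘ det)`) compatible with the twist `σ₀ ⊗ ψ` at all but finitely many places.

Inputs, all THEOREMS of the tree: the transport `τ = ι ∘ ψ⁻¹ : Γ_K → GL₁(ℂ)`
(`stub_existsCharacterTransport`, p124569); global class field theory for characters
(`artinReciprocity_character_holds`, packaged as `stub_existsHeckeCharacterOfTransport`, p124589:
a finite-order Hecke character `ω` with `ψ(Frob_v) = ι⁻¹(ω(ϖ_v)⁻¹)` wherever `τ` is unramified);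
`FramedArtinRep.eventually_isUnramifiedAt` (τ is unramified a.e.); the twisting theorem for
cuspidal Borel–Jacquet data `CuspidalAutomorphicRepData.exists_twist_hecke_hasSatakeParamAt`
(Borel–Jacquet 5.7 / Arthur–Clozel Ch. 3: `t_{π ⊗ ω, v} = ω(ϖ_v) t_{π, v}` a.e.); and the pointwise
dictionary `stub_twistDictionaryAt` (p124609).
-/

noncomputable section

open scoped BigOperators Topology Classical Matrix NumberField MatrixGroups
open Literature.NumberTheory.Automorphic Literature.NumberTheory.GaloisRepresentations
  IsDedekindDomain NumberField Filter

-- `Summit.Langlands.Langlands.…`: summit = sub-problem name (D-0017 nested layout), not a typo.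
set_option linter.dupNamespace false

namespace Summit.Langlands.Langlands.Theorems.ArtinWeightRealisationLevel

/-- **Twisting a.e. Satake–Frobenius compatibility by a finite-order character.**  For `K` a
number field, `ι : ℚ̄_p ≃+* ℂ`, a cuspidal `π` on `GL₂(𝔸_K)` compatible with `σ₀ : Γ_K → GL₂(ℚ̄_p)`
(m = 1 arithmetic normalisation) at all but finitely many places, and `ψ : Γ_K → ℚ̄_pˣ` continuous of
finite image: some cuspidal `π'` (the twist `π ⊗ (ω ∘ det)` by the class-field-theoretic Hecke
character `ω` of `ι ∘ ψ⁻¹`) is compatible with `σ₀ ⊗ ψ` at all but finitely many places.  Registered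
stub of crux stmt-Langlands-15111, line `Sketch` (c15). [folklore] -/
theorem stub_exists_eventually_satakeFrobCompatibleAt_twist : ∀ (K : Type) [Field K] [NumberField K] (p : ℕ) [Fact p.Prime] (ι : PadicAlgCl p ≃+* ℂ) (hcpt : Literature.NumberTheory.Automorphic.isCompact_glFiniteIntegralLevel 2 K) (π : Literature.NumberTheory.Automorphic.CuspidalAutomorphicRepData 2 K hcpt) (σ₀ : Literature.NumberTheory.GaloisRepresentations.FramedGaloisRep K (PadicAlgCl p) 2) (ψ : Field.absoluteGaloisGroup K →ₜ* (PadicAlgCl p)ˣ), Finite ψ.toMonoidHom.range → (∀ᶠ w : IsDedekindDomain.HeightOneSpectrum (NumberField.RingOfIntegers K) in Filter.cofinite, Summit.Langlands.SatakeFrobCompatibleAt ι π.1 σ₀ w) → ∃ π' : Literature.NumberTheory.Automorphic.CuspidalAutomorphicRepData 2 K hcpt, ∀ᶠ w : IsDedekindDomain.HeightOneSpectrum (NumberField.RingOfIntegers K) in Filter.cofinite, Summit.Langlands.SatakeFrobCompatibleAt ι π'.1 (Literature.NumberTheory.GaloisRepresentations.FramedRep.twist σ₀ ψ) w := by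
  intro K _ _ p _ ι hcpt π σ₀ ψ hfin hae
  -- transport `ι ∘ ψ⁻¹` to a rank-one Artin representation `τ`
  obtain ⟨τ, hτ⟩ := stub_existsCharacterTransport K p ι ψ hfin
  -- global class field theory: the Hecke character `ω` of `τ`
  obtain ⟨ω, -, hω⟩ := stub_existsHeckeCharacterOfTransport K p ι ψ τ hτ
  -- the twist `π ⊗ (ω ∘ det)` and its Satake parameters a.e.
  obtain ⟨π', hπ'⟩ := CuspidalAutomorphicRepData.exists_twist_hecke_hasSatakeParamAt ω π
  refine ⟨π', ?_⟩
  filter_upwards [hae, hπ', FramedArtinRep.eventually_isUnramifiedAt τ] with w hw htw hunr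
  obtain ⟨hI, -, hF⟩ := hω w hunr
  exact stub_twistDictionaryAt K p ι hcpt π.1 π'.1 σ₀ ψ w (ω.valueAtUniformizer w) (htw) hI hF hw

end Summit.Langlands.Langlands.Theorems.ArtinWeightRealisationLevel

end
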